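import Mathlib
import Literature.Geometry.Symplectic.StandardEnd
import Literature.Geometry.Symplectic.BoundaryChartImmersion
import HarnessLib

/-!
# Tame cut-off of the bi-foliation chart — auxiliary linear algebra and coordinates on `ℝ⁴`
(stub `stub_flatCutoff` of line `cross-cap-laurent`, crux `GromovRecognitionRelEnd`, item
stmt-SmoothPoincare4-11009; first of four files)

The stub cuts the bi-foliation chart `σ : M ≃ₘ ℝ⁴` of the line's apex off to the end chart `ψ` on
a far shell and checks that the pull-back of `ω₀` still tames `J`. This file collects the
self-contained coordinate and linear-algebra facts on `ℝ⁴ = EuclideanSpace ℝ (Fin 4)` used there: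

* the continuous linear maps `C w = (w₀, -w₁, 0, 0)`, `ι w = (0, 0, w₂, w₃)` and the factor swap
  `P w = (w₂, w₃, w₀, w₁)` (stated as existence theorems with their defining equations, so that no
  definition is introduced), the derivative of `s(w) = w₀² + w₁²`, and the derivative of the complex
  inversion of the first factor `T(z₁, z₂) = (1/z₁, z₂)` with the bound `‖DT(w) - ι‖ ≤ 5/|z₁|²`
  (`hasFDerivAt_invFirst`);
* near-identity operators: `A ∘ B = I`, `‖B - I‖ ≤ δ ≤ ½ ⟹ ‖A - I‖ ≤ 2δ`, and
  `‖A ∘ B - I‖ ≤ ‖A - I‖ + ‖B - I‖ + ‖A - I‖ ‖B - I‖`;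
* the standard symplectic form `ω₀ = stdSymplecticForm` against the standard complex structure
  `(i ⊕ i)(a) = (-a₁, a₀, -a₃, a₂)`: `ω₀(a, (i⊕i)a) = ‖a‖²`, `|ω₀(a, b)| ≤ ‖a‖ ‖b‖`, and the
  pointwise heart of the tameness clause of the stub: `‖L - I‖ ≤ 1/20 ⟹ ω₀(La, L(i⊕i)a) > 0` for
  `a ≠ 0` (`stdSymplecticForm_pos_of_norm_sub_id_le`; registered helper sub-goal
  `helper_flatCutoffLinearTame`).

Everything is proved; no definition, no named fact. (Extensionality by the four coordinates is the
tree's `Literature.Geometry.Symplectic.LegendrianDarboux.euclidean_four_ext`.)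

References: D. McDuff, D. Salamon, *Introduction to Symplectic Topology*, 3rd ed. (2017),
Rem. 4.5.2 (viii) [McDuffSalamon2017].
-/

noncomputable section

-- the registered namespace `Summit.SmoothPoincare4.SmoothPoincare4.Theorems…` repeats a component
set_option linter.dupNamespace false

open scoped Topology
open Set Filter Metric Literature.Geometry.Symplectic
open Literature.Geometry.Symplectic.LegendrianDarboux (euclidean_four_ext)

namespace Summit.SmoothPoincare4.SmoothPoincare4.Theorems.GromovRecognitionRelEnd.CrossCapLaurent

namespace FlatCutoff

/-- Model space `ℝ⁴ = ℂ²` (coordinates `0,1` = `z₁`, `2,3` = `z₂`). -/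
local notation "E4" => EuclideanSpace ℝ (Fin 4)
/-- `ℝ² = ℂ`, the coordinate plane of one factor. -/
local notation "E2" => EuclideanSpace ℝ (Fin 2)

/-! ## Coordinates on `ℝ⁴` -/

/-- `w₀² + w₁² ≤ ‖w‖²`. [folklore] -/
theorem sq01_le_norm_sq (w : E4) : w 0 ^ 2 + w 1 ^ 2 ≤ ‖w‖ ^ 2 := by
  rw [EuclideanSpace.real_norm_sq_eq, Fin.sum_univ_four]
  nlinarith [sq_nonneg (w 2), sq_nonneg (w 3)]

/-- `w₂² + w₃² ≤ ‖w‖²`. [folklore] -/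
theorem sq23_le_norm_sq (w : E4) : w 2 ^ 2 + w 3 ^ 2 ≤ ‖w‖ ^ 2 := by
  rw [EuclideanSpace.real_norm_sq_eq, Fin.sum_univ_four]
  nlinarith [sq_nonneg (w 0), sq_nonneg (w 1)]

/-- The linear map `C w = (w₀, -w₁, 0, 0)` (complex conjugation of `z₁`, killing `z₂`) as a
continuous linear map, with `‖C w‖² = w₀² + w₁²` and `‖C‖ ≤ 1`. [folklore] -/
theorem exists_clm_conj01 : ∃ C : E4 →L[ℝ] E4,
    (∀ w : E4, C w = WithLp.toLp 2 ![w 0, -(w 1), 0, 0]) ∧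
    (∀ w : E4, ‖C w‖ ^ 2 = w 0 ^ 2 + w 1 ^ 2) ∧ (∀ w : E4, ‖C w‖ ≤ ‖w‖) ∧ ‖C‖ ≤ 1 := by
  let L : E4 →ₗ[ℝ] E4 :=
    { toFun := fun w => WithLp.toLp 2 ![w 0, -(w 1), 0, 0]
      map_add' := fun v w => by ext i; fin_cases i <;> simp [add_comm]
      map_smul' := fun c w => by ext i; fin_cases i <;> simp }
  have hL : ∀ w : E4, L w = WithLp.toLp 2 ![w 0, -(w 1), 0, 0] := fun w => rfl
  have hn2 : ∀ w : E4, ‖L w‖ ^ 2 = w 0 ^ 2 + w 1 ^ 2 := fun w => by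
    rw [hL, EuclideanSpace.real_norm_sq_eq, Fin.sum_univ_four]; simp
  have hn : ∀ w : E4, ‖L w‖ ≤ ‖w‖ := fun w =>
    (sq_le_sq₀ (norm_nonneg _) (norm_nonneg _)).1 ((hn2 w).le.trans (sq01_le_norm_sq w))
  refine ⟨LinearMap.toContinuousLinearMap L, fun w => hL w, fun w => hn2 w, fun w => hn w, ?_⟩
  exact ContinuousLinearMap.opNorm_le_bound _ zero_le_one fun w => by simpa using hn w

/-- The projection `ι w = (0, 0, w₂, w₃)` onto the axis `z₁ = 0` as a continuous linear map,
with `‖ι‖ ≤ 1`. [folklore] -/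
theorem exists_clm_axis23 : ∃ ι : E4 →L[ℝ] E4,
    (∀ w : E4, ι w = WithLp.toLp 2 ![0, 0, w 2, w 3]) ∧ (∀ w : E4, ‖ι w‖ ≤ ‖w‖) ∧ ‖ι‖ ≤ 1 := by
  let L : E4 →ₗ[ℝ] E4 :=
    { toFun := fun w => WithLp.toLp 2 ![0, 0, w 2, w 3]
      map_add' := fun v w => by ext i; fin_cases i <;> simp
      map_smul' := fun c w => by ext i; fin_cases i <;> simp }
  have hL : ∀ w : E4, L w = WithLp.toLp 2 ![0, 0, w 2, w 3] := fun w => rfl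
  have hn : ∀ w : E4, ‖L w‖ ≤ ‖w‖ := fun w => by
    refine (sq_le_sq₀ (norm_nonneg _) (norm_nonneg _)).1 ?_
    rw [hL, EuclideanSpace.real_norm_sq_eq (WithLp.toLp 2 _), Fin.sum_univ_four]
    simpa using sq23_le_norm_sq w
  refine ⟨LinearMap.toContinuousLinearMap L, fun w => hL w, fun w => hn w, ?_⟩
  exact ContinuousLinearMap.opNorm_le_bound _ zero_le_one fun w => by simpa using hn w

/-- The derivative of `s(w) = w₀² + w₁²`: `Ds(w) v = 2 w₀ v₀ + 2 w₁ v₁`, of norm `≤ 4 √s`.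
[folklore] -/
theorem hasFDerivAt_sq01 (w : E4) : ∃ s' : E4 →L[ℝ] ℝ,
    HasFDerivAt (fun v : E4 => v 0 ^ 2 + v 1 ^ 2) s' w ∧
    (∀ v : E4, s' v = 2 * w 0 * v 0 + 2 * w 1 * v 1) ∧
    ∀ v : E4, |s' v| ≤ 4 * Real.sqrt (w 0 ^ 2 + w 1 ^ 2) * ‖v‖ := by
  have h0 : HasFDerivAt (fun v : E4 => v 0) (EuclideanSpace.proj (𝕜 := ℝ) (0 : Fin 4)) w :=
    (EuclideanSpace.proj (𝕜 := ℝ) (0 : Fin 4)).hasFDerivAt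
  have h1 : HasFDerivAt (fun v : E4 => v 1) (EuclideanSpace.proj (𝕜 := ℝ) (1 : Fin 4)) w :=
    (EuclideanSpace.proj (𝕜 := ℝ) (1 : Fin 4)).hasFDerivAt
  set s' : E4 →L[ℝ] ℝ := (2 * w 0) • EuclideanSpace.proj (𝕜 := ℝ) (0 : Fin 4) +
    (2 * w 1) • EuclideanSpace.proj (𝕜 := ℝ) (1 : Fin 4) with hs'
  have hs'v : ∀ v : E4, s' v = 2 * w 0 * v 0 + 2 * w 1 * v 1 := fun v => by
    simp [hs']
  have h : HasFDerivAt (fun v : E4 => v 0 ^ 2 + v 1 ^ 2) s' w := by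
    refine ((h0.pow 2).fun_add (h1.pow 2)).congr_fderiv ?_
    ext v
    rw [hs'v]
    simp
  refine ⟨s', h, hs'v, fun v => ?_⟩
  rw [hs'v]
  have hs : |w 0| ≤ Real.sqrt (w 0 ^ 2 + w 1 ^ 2) :=
    Real.abs_le_sqrt (by nlinarith [sq_nonneg (w 1)])
  have hs'' : |w 1| ≤ Real.sqrt (w 0 ^ 2 + w 1 ^ 2) :=
    Real.abs_le_sqrt (by nlinarith [sq_nonneg (w 0)])
  have hv0 : |v 0| ≤ ‖v‖ := by simpa using PiLp.norm_apply_le v 0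
  have hv1 : |v 1| ≤ ‖v‖ := by simpa using PiLp.norm_apply_le v 1
  calc |2 * w 0 * v 0 + 2 * w 1 * v 1| ≤ |2 * w 0 * v 0| + |2 * w 1 * v 1| := abs_add_le _ _
    _ = 2 * (|w 0| * |v 0|) + 2 * (|w 1| * |v 1|) := by
        simp only [abs_mul, abs_two]
        ring
    _ ≤ 2 * (Real.sqrt (w 0 ^ 2 + w 1 ^ 2) * ‖v‖) +
        2 * (Real.sqrt (w 0 ^ 2 + w 1 ^ 2) * ‖v‖) := by
        gcongr
    _ = 4 * Real.sqrt (w 0 ^ 2 + w 1 ^ 2) * ‖v‖ := by ring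

/-- The complex inversion of the first factor, `T(z₁, z₂) = (1/z₁, z₂)`, in real coordinates
`T w = (w₀/s, -w₁/s, w₂, w₃)` with `s = w₀² + w₁²`: off the axis `{z₁ = 0}` it is differentiable
and its derivative differs from the axis projection `ι` by at most `5/s` in operator norm (the
exact value is `1/s = |z₁|⁻²`). [folklore] -/
theorem hasFDerivAt_invFirst (ι : E4 →L[ℝ] E4)
    (hι : ∀ w : E4, ι w = WithLp.toLp 2 ![0, 0, w 2, w 3]) (w : E4) (hw : w 0 ^ 2 + w 1 ^ 2 ≠ 0) :
    ∃ T' : E4 →L[ℝ] E4,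
      HasFDerivAt (fun v : E4 => (WithLp.toLp 2
        ![v 0 / (v 0 ^ 2 + v 1 ^ 2), -(v 1) / (v 0 ^ 2 + v 1 ^ 2), v 2, v 3] : E4)) T' w ∧
      ‖T' - ι‖ ≤ 5 / (w 0 ^ 2 + w 1 ^ 2) := by
  obtain ⟨C, hC, hC2, hCle, -⟩ := exists_clm_conj01
  obtain ⟨s', hs', -, hs'b⟩ := hasFDerivAt_sq01 w
  have hT : (fun v : E4 => (WithLp.toLp 2
      ![v 0 / (v 0 ^ 2 + v 1 ^ 2), -(v 1) / (v 0 ^ 2 + v 1 ^ 2), v 2, v 3] : E4)) =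
      fun v => (v 0 ^ 2 + v 1 ^ 2)⁻¹ • C v + ι v := by
    funext v
    rw [hC, hι]
    ext i
    fin_cases i <;> simp [div_eq_inv_mul]
  have hinv : HasFDerivAt (fun v : E4 => (v 0 ^ 2 + v 1 ^ 2)⁻¹)
      ((-((w 0 ^ 2 + w 1 ^ 2) ^ 2)⁻¹) • s') w :=
    (hasDerivAt_inv hw).comp_hasFDerivAt w hs'
  have hTd : HasFDerivAt (fun v : E4 => (v 0 ^ 2 + v 1 ^ 2)⁻¹ • C v + ι v)
      ((w 0 ^ 2 + w 1 ^ 2)⁻¹ • C + ((-((w 0 ^ 2 + w 1 ^ 2) ^ 2)⁻¹) • s').smulRight (C w) + ι)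
      w :=
    (hinv.smul C.hasFDerivAt).add ι.hasFDerivAt
  refine ⟨_, hT ▸ hTd, ?_⟩
  set s := w 0 ^ 2 + w 1 ^ 2 with hs
  have hspos : 0 < s := lt_of_le_of_ne (by positivity) (Ne.symm hw)
  have hCw : ‖C w‖ = Real.sqrt s := by
    have h := hC2 w
    rw [← hs] at h
    rw [← h, Real.sqrt_sq (norm_nonneg _)]
  rw [add_sub_cancel_right]
  refine ContinuousLinearMap.opNorm_le_bound _ (by positivity) fun v => ?_
  have hsv := hs'b v
  calc ‖(s⁻¹ • C + ((-(s ^ 2)⁻¹) • s').smulRight (C w)) v‖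
        = ‖s⁻¹ • C v + ((-(s ^ 2)⁻¹) * s' v) • C w‖ := by
          simp [ContinuousLinearMap.smulRight_apply, smul_eq_mul]
    _ ≤ ‖s⁻¹ • C v‖ + ‖((-(s ^ 2)⁻¹) * s' v) • C w‖ := norm_add_le _ _
    _ = s⁻¹ * ‖C v‖ + (s ^ 2)⁻¹ * |s' v| * Real.sqrt s := by
          rw [norm_smul, norm_smul, hCw, Real.norm_eq_abs, Real.norm_eq_abs, abs_inv,
            abs_of_pos hspos, abs_mul, abs_neg, abs_inv, abs_of_pos (by positivity : 0 < s ^ 2),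
            mul_assoc]
    _ ≤ s⁻¹ * ‖v‖ + (s ^ 2)⁻¹ * (4 * Real.sqrt s * ‖v‖) * Real.sqrt s := by
          gcongr
          exact hCle v
    _ = 5 / s * ‖v‖ := by
          have hss : Real.sqrt s * Real.sqrt s = s := Real.mul_self_sqrt hspos.le
          have e : (s ^ 2)⁻¹ * (4 * Real.sqrt s * ‖v‖) * Real.sqrt s =
              4 * ‖v‖ * (Real.sqrt s * Real.sqrt s) / s ^ 2 := by ring
          rw [e, hss]
          field_simp
          ring


/-! ## The factor swap -/

/-- The factor swap `(z₁, z₂) ↦ (z₂, z₁)` of `ℂ² = ℝ⁴` as a continuous linear map: an isometric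
involution. [folklore] -/
theorem exists_clm_swap : ∃ P : E4 →L[ℝ] E4,
    (∀ w : E4, P w = WithLp.toLp 2 ![w 2, w 3, w 0, w 1]) ∧ (∀ w : E4, P (P w) = w) ∧
    (∀ w : E4, ‖P w‖ = ‖w‖) ∧ ‖P‖ ≤ 1 := by
  let L : E4 →ₗ[ℝ] E4 :=
    { toFun := fun w => WithLp.toLp 2 ![w 2, w 3, w 0, w 1]
      map_add' := fun v w => by ext i; fin_cases i <;> simp
      map_smul' := fun c w => by ext i; fin_cases i <;> simp }
  have hL : ∀ w : E4, L w = WithLp.toLp 2 ![w 2, w 3, w 0, w 1] := fun w => rfl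
  have hn : ∀ w : E4, ‖L w‖ = ‖w‖ := fun w => by
    refine (sq_eq_sq₀ (norm_nonneg _) (norm_nonneg _)).1 ?_
    rw [hL, EuclideanSpace.real_norm_sq_eq, EuclideanSpace.real_norm_sq_eq, Fin.sum_univ_four,
      Fin.sum_univ_four]
    simp only [Matrix.cons_val_zero, Matrix.cons_val_one, Matrix.cons_val]
    ring
  refine ⟨LinearMap.toContinuousLinearMap L, fun w => hL w, fun w => ?_, fun w => hn w, ?_⟩
  · refine euclidean_four_ext ?_ ?_ ?_ ?_ <;> simp [hL]
  · exact ContinuousLinearMap.opNorm_le_bound _ zero_le_one fun w => by simp [hn w]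

section General

variable {E : Type*} [NormedAddCommGroup E] [NormedSpace ℝ E]

/-- If `A ∘ B = id` and `‖B - id‖ ≤ δ ≤ 1/2` then `‖A - id‖ ≤ 2δ` (Neumann-series estimate for
the inverse, in the crude form `δ/(1-δ) ≤ 2δ`). [folklore] -/
theorem norm_sub_id_le_of_comp_eq_id {A B : E →L[ℝ] E} {δ : ℝ}
    (h : A.comp B = ContinuousLinearMap.id ℝ E)
    (hB : ‖B - ContinuousLinearMap.id ℝ E‖ ≤ δ) (hδ : δ ≤ 1 / 2) :
    ‖A - ContinuousLinearMap.id ℝ E‖ ≤ 2 * δ := by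
  have e : A - ContinuousLinearMap.id ℝ E = A.comp (ContinuousLinearMap.id ℝ E - B) := by
    rw [ContinuousLinearMap.comp_sub, h, ContinuousLinearMap.comp_id]
  have hδ0 : 0 ≤ δ := (norm_nonneg _).trans hB
  have h1 : ‖A - ContinuousLinearMap.id ℝ E‖ ≤ ‖A‖ * δ := by
    rw [e]
    refine (ContinuousLinearMap.opNorm_comp_le _ _).trans ?_
    refine mul_le_mul_of_nonneg_left ?_ (norm_nonneg _)
    rwa [norm_sub_rev]
  have h2 : ‖A‖ ≤ ‖A - ContinuousLinearMap.id ℝ E‖ + 1 := by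
    calc ‖A‖ = ‖(A - ContinuousLinearMap.id ℝ E) + ContinuousLinearMap.id ℝ E‖ := by
          rw [sub_add_cancel]
      _ ≤ ‖A - ContinuousLinearMap.id ℝ E‖ + ‖ContinuousLinearMap.id ℝ E‖ := norm_add_le _ _
      _ ≤ ‖A - ContinuousLinearMap.id ℝ E‖ + 1 := by
          gcongr; exact ContinuousLinearMap.norm_id_le
  have h3 : ‖A‖ * δ ≤ (‖A - ContinuousLinearMap.id ℝ E‖ + 1) * δ :=
    mul_le_mul_of_nonneg_right h2 hδ0
  nlinarith [h1, h3, norm_nonneg (A - ContinuousLinearMap.id ℝ E)]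

/-- `‖A ∘ B - id‖ ≤ ‖A - id‖ + ‖B - id‖ + ‖A - id‖ ‖B - id‖`. [folklore] -/
theorem norm_comp_sub_id_le (A B : E →L[ℝ] E) :
    ‖A.comp B - ContinuousLinearMap.id ℝ E‖ ≤
      ‖A - ContinuousLinearMap.id ℝ E‖ + ‖B - ContinuousLinearMap.id ℝ E‖ +
        ‖A - ContinuousLinearMap.id ℝ E‖ * ‖B - ContinuousLinearMap.id ℝ E‖ := by
  have e : A.comp B - ContinuousLinearMap.id ℝ E =
      (A - ContinuousLinearMap.id ℝ E) + (B - ContinuousLinearMap.id ℝ E) +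
        (A - ContinuousLinearMap.id ℝ E).comp (B - ContinuousLinearMap.id ℝ E) := by
    simp only [ContinuousLinearMap.sub_comp, ContinuousLinearMap.comp_sub,
      ContinuousLinearMap.id_comp, ContinuousLinearMap.comp_id]
    abel
  rw [e]
  exact (norm_add_le _ _).trans (add_le_add (norm_add_le _ _)
    (ContinuousLinearMap.opNorm_comp_le _ _))

end General

/-! ## The standard symplectic form against a near-identity linear map -/

/-- Cauchy–Schwarz for `ω₀`: `|ω₀(a, b)| ≤ ‖a‖ ‖b‖` (Lagrange's identity against the rotated
vector `(b₁, -b₀, b₃, -b₂)`). [folklore] -/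
theorem abs_stdSymplecticForm_le (a b : E4) : |stdSymplecticForm a b| ≤ ‖a‖ * ‖b‖ := by
  refine abs_le_of_sq_le_sq ?_ (by positivity)
  rw [mul_pow, EuclideanSpace.real_norm_sq_eq, EuclideanSpace.real_norm_sq_eq, Fin.sum_univ_four,
    Fin.sum_univ_four]
  simp only [stdSymplecticForm]
  nlinarith [sq_nonneg (a 0 * b 0 + a 1 * b 1), sq_nonneg (a 0 * b 3 - a 2 * b 1),
    sq_nonneg (a 0 * b 2 + a 3 * b 1), sq_nonneg (a 1 * b 3 + a 2 * b 0),
    sq_nonneg (a 1 * b 2 - a 3 * b 0), sq_nonneg (a 2 * b 2 + a 3 * b 3)]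

/-- `ω₀(a, (i ⊕ i) a) = ‖a‖²` for the standard complex structure
`(i ⊕ i)(a) = (-a₁, a₀, -a₃, a₂)`. [folklore] -/
theorem stdSymplecticForm_I4_eq_norm_sq (a : E4) :
    stdSymplecticForm a (WithLp.toLp 2 ![-(a 1), a 0, -(a 3), a 2]) = ‖a‖ ^ 2 := by
  rw [EuclideanSpace.real_norm_sq_eq, Fin.sum_univ_four]
  simp [stdSymplecticForm]
  ring

/-- `i ⊕ i` is an isometry: `‖(-a₁, a₀, -a₃, a₂)‖ = ‖a‖`. [folklore] -/
theorem norm_I4 (a : E4) : ‖(WithLp.toLp 2 ![-(a 1), a 0, -(a 3), a 2] : E4)‖ = ‖a‖ := by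
  refine (sq_eq_sq₀ (norm_nonneg _) (norm_nonneg _)).1 ?_
  rw [EuclideanSpace.real_norm_sq_eq, EuclideanSpace.real_norm_sq_eq, Fin.sum_univ_four,
    Fin.sum_univ_four]
  simp
  ring

/-- **Tameness survives a `C¹`-small perturbation.** If `L : ℝ⁴ → ℝ⁴` is linear with
`‖L - I‖ ≤ 1/20`, then `ω₀(L a, L (i ⊕ i) a) > 0` for `a ≠ 0`:
`ω₀((I+E)a, (I+E)Ja) = ‖a‖² + ω₀(a, EJa) + ω₀(Ea, Ja) + ω₀(Ea, EJa) ≥ (1 - 2‖E‖ - ‖E‖²)‖a‖²`.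
[folklore] -/
theorem stdSymplecticForm_pos_of_norm_sub_id_le (L : E4 →L[ℝ] E4)
    (hL : ‖L - ContinuousLinearMap.id ℝ E4‖ ≤ 1 / 20) (a : E4) (ha : a ≠ 0) :
    0 < stdSymplecticForm (L a) (L (WithLp.toLp 2 ![-(a 1), a 0, -(a 3), a 2])) := by
  set Ei : E4 →L[ℝ] E4 := L - ContinuousLinearMap.id ℝ E4 with hE
  set b : E4 := WithLp.toLp 2 ![-(a 1), a 0, -(a 3), a 2] with hb
  have hLa : L a = a + Ei a := by simp [hE]
  have hLb : L b = b + Ei b := by simp [hE]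
  have hnb : ‖b‖ = ‖a‖ := norm_I4 a
  have hEa : ‖Ei a‖ ≤ 1 / 20 * ‖a‖ :=
    (Ei.le_opNorm a).trans (mul_le_mul_of_nonneg_right hL (norm_nonneg _))
  have hEb : ‖Ei b‖ ≤ 1 / 20 * ‖a‖ :=
    (Ei.le_opNorm b).trans (hnb ▸ mul_le_mul_of_nonneg_right hL (norm_nonneg _))
  have hadd_left : ∀ p q r : E4, stdSymplecticForm (p + q) r =
      stdSymplecticForm p r + stdSymplecticForm q r := fun p q r => by
    simp only [stdSymplecticForm, PiLp.add_apply]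
    ring
  have hadd_right : ∀ p q r : E4, stdSymplecticForm p (q + r) =
      stdSymplecticForm p q + stdSymplecticForm p r := fun p q r => by
    simp only [stdSymplecticForm, PiLp.add_apply]
    ring
  rw [hLa, hLb, hadd_left, hadd_right, hadd_right, stdSymplecticForm_I4_eq_norm_sq]
  have h1 := abs_le.1 (abs_stdSymplecticForm_le a (Ei b))
  have h2 := abs_le.1 (abs_stdSymplecticForm_le (Ei a) b)
  have h3 := abs_le.1 (abs_stdSymplecticForm_le (Ei a) (Ei b))
  have ha' : 0 < ‖a‖ := norm_pos_iff.2 ha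
  have k1 : ‖a‖ * ‖Ei b‖ ≤ ‖a‖ * (1 / 20 * ‖a‖) := mul_le_mul_of_nonneg_left hEb (norm_nonneg a)
  have k2 : ‖Ei a‖ * ‖b‖ ≤ (1 / 20 * ‖a‖) * ‖a‖ := by
    rw [hnb]
    exact mul_le_mul_of_nonneg_right hEa (norm_nonneg a)
  have k3 : ‖Ei a‖ * ‖Ei b‖ ≤ (1 / 20 * ‖a‖) * (1 / 20 * ‖a‖) :=
    mul_le_mul hEa hEb (norm_nonneg _) (by positivity)
  nlinarith [h1.1, h2.1, h3.1, k1, k2, k3, pow_pos ha' 2]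

end FlatCutoff

/-- **Registered helper sub-goal `helper_flatCutoffLinearTame`** (first auxiliary file of stub
`stub_flatCutoff`): tameness of `ω₀` on `i ⊕ i` survives a linear perturbation of operator norm
`≤ 1/20` — the pointwise heart of the tameness clause of the stub. [folklore] -/
theorem helper_flatCutoffLinearTame :
    ∀ (L : EuclideanSpace ℝ (Fin 4) →L[ℝ] EuclideanSpace ℝ (Fin 4)),
      ‖L - ContinuousLinearMap.id ℝ (EuclideanSpace ℝ (Fin 4))‖ ≤ 1 / 20 →
      ∀ a : EuclideanSpace ℝ (Fin 4), a ≠ 0 →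
        0 < Literature.Geometry.Symplectic.stdSymplecticForm (L a)
          (L (WithLp.toLp 2 ![-(a 1), a 0, -(a 3), a 2])) :=
  fun L hL a ha => FlatCutoff.stdSymplecticForm_pos_of_norm_sub_id_le L hL a ha

end Summit.SmoothPoincare4.SmoothPoincare4.Theorems.GromovRecognitionRelEnd.CrossCapLaurent

end
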